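import Summits.RiemannHypothesis.RiemannHypothesis.Theorems.PfPersistenceConeSigns
import Summits.RiemannHypothesis.RiemannHypothesis.Theorems.PfPersistenceF2PlantedIndex
import HarnessLib

/-!
# PF persistence — RESOLVENT SIGN: the bottom vector of a rank-one perturbation is the resolvent vector
(pub-rhpf, barrier-prover gen 3; the data-facing companion of `PfPersistenceRankOneDominance`, typed at the request
of `pub-rhpf-ctrl-2` g7, planted-polepair table `verify/out_ppreg/pp_prereg.tsv`)

**HONEST FRAMING. This is a long-odds MECHANISM SEARCH; no RH claims.** RH-free finite-dimensional linear algebra;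
no `ζ` statement occurs. Every statement PROVED; hypotheses are arguments, never asserted.

THE LEMMA. Let `T` be any real square matrix, `u` a vector, `c` a scalar, `M := T − c·uuᵀ`, `λ₁ := ε₁(M)`
(`bottomRayleigh`). IF `λ₁ < ε₁(T)` (the rank-one part pushes the bottom STRICTLY below the host's bottom —
scoreable: any vector `v` with `vᵀMv < ε₁(T)|v|²` certifies it) and `r` solves `(T − λ₁)r = u` (the RESOLVENT
VECTOR at the bottom), THEN every bottom vector `x` of `M` is a NONZERO multiple of `r`
(`isBottomVector_eq_smul_resolvent`: `x = c(u·x)·r`, `c(u·x) ≠ 0`). Consequences: the bottom eigenspace is a line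
(`bottom_simple_of_resolvent`); if `r` is coordinatewise positive, every bottom vector is strictly one-signed
coordinatewise (`oneSign_of_resolvent_pos`); if the PROFILE of `r` is one-signed on the window, so is the profile
of every bottom vector (`oneSigned_of_resolvent_oneSigned`, theta tier). No symmetry, no dominance threshold: this
is the regime `λ₁ ≪ d₁` of the planted-polepair controls, where the crude dominance inequality of
`rankOneDominance` may fail although the bottom vector `≈ (T − λ₁)⁻¹u` is manifestly one-signed (DATA, ctrl-2).

PRIOR ART IN THE TREE (cited, not duplicated): the identity "eigenvector of a rank-one modification = multiple of the
resolvent vector" is Golub–Van Loan, *Matrix Computations*, Thm 8.4.3 (c); it is recorded dimension-free as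
`Literature.Analysis.InnerProduct.rankOne_downdate_eigenvector_eq_smul` (hypotheses: host form `≥ 0`, eigenvalue
`< 0`) and instantiated by `pub-rhpf-theory-3` as `PfPersistenceIntruderShadow.intruder_eq_smul_resolvent`. What this
file adds is only the cell's MATRIX / `IsBottomVector` dialect with the host-positivity hypothesis replaced by the
single separation `ε₁(T − c·uuᵀ) < ε₁(T)` (indefinite hosts allowed), and the SIGN TRANSFER to coordinates and to
window profiles (`OneSigned`), which is what the class-level walls (`oneSignedAt`, `PfPersistenceEigenvectorTolerance`)
consume.
-/

set_option linter.dupNamespace false  -- the mandated namespace repeats `RiemannHypothesis`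

noncomputable section

open Real Finset Matrix Set

namespace Summit.RiemannHypothesis.RiemannHypothesis.Theorems.PfPersistence

/-! ## §1 Injectivity of `T − λ` below the bottom of the spectrum -/

/-- PROVED: the form of `T − λ·1` is `vᵀTv − λ|v|²`. [folklore] -/
theorem form_sub_smul_one {n : ℕ} (T : Matrix (Fin n) (Fin n) ℝ) (lam : ℝ) (v : Fin n → ℝ) :
    v ⬝ᵥ ((T - lam • (1 : Matrix (Fin n) (Fin n) ℝ)) *ᵥ v) = v ⬝ᵥ (T *ᵥ v) - lam * (v ⬝ᵥ v) := by
  simp only [sub_mulVec, Matrix.smul_mulVec, one_mulVec, dotProduct_sub, dotProduct_smul, smul_eq_mul]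

/-- **PROVED — BELOW THE BOTTOM, `T − λ` KILLS NO NONZERO VECTOR** (`λ < ε₁(T)`, `v ≠ 0` ⇒ `(T − λ)v ≠ 0`).
[folklore] -/
theorem mulVec_sub_smul_one_ne_zero {n : ℕ} (T : Matrix (Fin n) (Fin n) ℝ) {lam : ℝ} (hlam : lam < bottomRayleigh T)
    {v : Fin n → ℝ} (hv : v ≠ 0) : (T - lam • (1 : Matrix (Fin n) (Fin n) ℝ)) *ᵥ v ≠ 0 := by
  intro h0
  have hvv : 0 < v ⬝ᵥ v := dotSelf_pos_of_ne_zero hv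
  have hform := form_sub_smul_one T lam v
  rw [h0, dotProduct_zero] at hform
  have hbot := bottomRayleigh_mul_le_form T v
  nlinarith

/-- PROVED: hence `T − λ` is injective below the bottom. [folklore] -/
theorem mulVec_sub_smul_one_injective {n : ℕ} (T : Matrix (Fin n) (Fin n) ℝ) {lam : ℝ}
    (hlam : lam < bottomRayleigh T) {v w : Fin n → ℝ}
    (h : (T - lam • (1 : Matrix (Fin n) (Fin n) ℝ)) *ᵥ v = (T - lam • (1 : Matrix (Fin n) (Fin n) ℝ)) *ᵥ w) :
    v = w := by
  by_contra hne
  refine mulVec_sub_smul_one_ne_zero T hlam (sub_ne_zero.2 hne) ?_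
  rw [mulVec_sub, h, sub_self]

/-! ## §2 The bottom vector of `T − c·uuᵀ` is the resolvent vector -/

/-- PROVED: the eigen-equation of a bottom vector of `T − c·uuᵀ`, rearranged: `(T − λ₁)x = c(u·x)·u`. [folklore] -/
theorem mulVec_sub_bottom_of_isBottomVector_rankOne {n : ℕ} {T : Matrix (Fin n) (Fin n) ℝ} {u : Fin n → ℝ}
    {c : ℝ} {x : Fin n → ℝ} (hx : IsBottomVector (T - c • vecMulVec u u) x) :
    (T - bottomRayleigh (T - c • vecMulVec u u) • (1 : Matrix (Fin n) (Fin n) ℝ)) *ᵥ x = (c * (u ⬝ᵥ x)) • u := by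
  have heig := hx.2
  rw [sub_mulVec, Matrix.smul_mulVec, PfPersistenceF2PlantedIndex.vecMulVec_mulVec_eq, smul_smul,
    sub_eq_iff_eq_add] at heig
  rw [sub_mulVec, Matrix.smul_mulVec, one_mulVec, heig, add_sub_cancel_left]

/-- **PROVED — THE RESOLVENT-SIGN LEMMA, core.** If `λ₁ := ε₁(T − c·uuᵀ) < ε₁(T)` and `(T − λ₁)r = u`, then every
bottom vector `x` of `T − c·uuᵀ` equals `c(u·x)·r` with `c(u·x) ≠ 0`. [folklore] -/
theorem isBottomVector_eq_smul_resolvent {n : ℕ} {T : Matrix (Fin n) (Fin n) ℝ} {u : Fin n → ℝ} {c : ℝ}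
    (hsep : bottomRayleigh (T - c • vecMulVec u u) < bottomRayleigh T) {r : Fin n → ℝ}
    (hr : (T - bottomRayleigh (T - c • vecMulVec u u) • (1 : Matrix (Fin n) (Fin n) ℝ)) *ᵥ r = u)
    {x : Fin n → ℝ} (hx : IsBottomVector (T - c • vecMulVec u u) x) :
    x = (c * (u ⬝ᵥ x)) • r ∧ c * (u ⬝ᵥ x) ≠ 0 := by
  have hx' : x = (c * (u ⬝ᵥ x)) • r := by
    refine mulVec_sub_smul_one_injective T hsep ?_
    rw [mulVec_sub_bottom_of_isBottomVector_rankOne hx, mulVec_smul, hr]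
  refine ⟨hx', fun h0 => hx.1 ?_⟩
  rw [hx', h0, zero_smul]

/-- **PROVED — SIMPLE BOTTOM.** Under the same hypotheses the bottom eigenspace of `T − c·uuᵀ` is a line: any two
bottom vectors are proportional. [folklore] -/
theorem bottom_simple_of_resolvent {n : ℕ} {T : Matrix (Fin n) (Fin n) ℝ} {u : Fin n → ℝ} {c : ℝ}
    (hsep : bottomRayleigh (T - c • vecMulVec u u) < bottomRayleigh T) {r : Fin n → ℝ}
    (hr : (T - bottomRayleigh (T - c • vecMulVec u u) • (1 : Matrix (Fin n) (Fin n) ℝ)) *ᵥ r = u)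
    {x y : Fin n → ℝ} (hx : IsBottomVector (T - c • vecMulVec u u) x)
    (hy : IsBottomVector (T - c • vecMulVec u u) y) : ∃ t : ℝ, y = t • x := by
  obtain ⟨hx', hkx⟩ := isBottomVector_eq_smul_resolvent hsep hr hx
  obtain ⟨hy', -⟩ := isBottomVector_eq_smul_resolvent hsep hr hy
  refine ⟨c * (u ⬝ᵥ y) / (c * (u ⬝ᵥ x)), ?_⟩
  have h1 : (c * (u ⬝ᵥ y) / (c * (u ⬝ᵥ x))) • x =
      (c * (u ⬝ᵥ y) / (c * (u ⬝ᵥ x))) • ((c * (u ⬝ᵥ x)) • r) := by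
    rw [← hx']
  rw [h1, smul_smul, div_mul_cancel₀ _ hkx]
  exact hy'

/-! ## §3 Signs: coordinates and profiles -/

/-- **PROVED — RESOLVENT SIGN, coordinates.** If moreover the resolvent vector `r` is coordinatewise positive, every
bottom vector of `T − c·uuᵀ` is strictly one-signed coordinatewise. [folklore] -/
theorem oneSign_of_resolvent_pos {n : ℕ} {T : Matrix (Fin n) (Fin n) ℝ} {u : Fin n → ℝ} {c : ℝ}
    (hsep : bottomRayleigh (T - c • vecMulVec u u) < bottomRayleigh T) {r : Fin n → ℝ}
    (hr : (T - bottomRayleigh (T - c • vecMulVec u u) • (1 : Matrix (Fin n) (Fin n) ℝ)) *ᵥ r = u)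
    (hrpos : ∀ i, 0 < r i) {x : Fin n → ℝ} (hx : IsBottomVector (T - c • vecMulVec u u) x) :
    (∀ i, 0 < x i) ∨ (∀ i, x i < 0) := by
  obtain ⟨hx', hk⟩ := isBottomVector_eq_smul_resolvent hsep hr hx
  rcases lt_or_gt_of_ne hk with hneg | hpos
  · refine Or.inr fun i => ?_
    rw [hx', Pi.smul_apply, smul_eq_mul]
    exact mul_neg_of_neg_of_pos hneg (hrpos i)
  · refine Or.inl fun i => ?_
    rw [hx', Pi.smul_apply, smul_eq_mul]
    exact mul_pos hpos (hrpos i)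

/-- **PROVED — RESOLVENT SIGN, profiles (theta tier).** If the window PROFILE of the resolvent vector `r` is one-signed
on `[−L/2, L/2]`, so is the profile of every bottom vector of `T − c·uuᵀ`. [folklore] -/
theorem oneSigned_of_resolvent_oneSigned {N : ℕ} {T : Matrix (Fin (N + 1)) (Fin (N + 1)) ℝ} {u : Fin (N + 1) → ℝ}
    {c : ℝ} (hsep : bottomRayleigh (T - c • vecMulVec u u) < bottomRayleigh T) {r : Fin (N + 1) → ℝ}
    (hr : (T - bottomRayleigh (T - c • vecMulVec u u) • (1 : Matrix (Fin (N + 1)) (Fin (N + 1)) ℝ)) *ᵥ r = u)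
    {L : ℝ} (hr1 : OneSigned L r) {x : Fin (N + 1) → ℝ} (hx : IsBottomVector (T - c • vecMulVec u u) x) :
    OneSigned L x := by
  obtain ⟨hx', hk⟩ := isBottomVector_eq_smul_resolvent hsep hr hx
  rw [hx']
  rcases hr1 with hpos | hneg
  · rcases le_or_gt 0 (c * (u ⬝ᵥ x)) with hk0 | hk0
    · exact Or.inl fun y hy => by rw [profile_smul_vec]; exact mul_nonneg hk0 (hpos y hy)
    · exact Or.inr fun y hy => by rw [profile_smul_vec]; exact mul_nonpos_of_nonpos_of_nonneg hk0.le (hpos y hy)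
  · rcases le_or_gt 0 (c * (u ⬝ᵥ x)) with hk0 | hk0
    · exact Or.inr fun y hy => by rw [profile_smul_vec]; exact mul_nonpos_of_nonneg_of_nonpos hk0 (hneg y hy)
    · exact Or.inl fun y hy => by rw [profile_smul_vec]; exact mul_nonneg_of_nonpos_of_nonpos hk0.le (hneg y hy)

/-- **PROVED — RESOLVENT SIGN WITH MARGIN transfers one-signedness too** (a margin `m ≥ 0` on `r`'s profile is in
particular one-signedness). [folklore] -/
theorem oneSigned_of_resolvent_oneSignedMargin {N : ℕ} {T : Matrix (Fin (N + 1)) (Fin (N + 1)) ℝ}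
    {u : Fin (N + 1) → ℝ} {c : ℝ} (hsep : bottomRayleigh (T - c • vecMulVec u u) < bottomRayleigh T)
    {r : Fin (N + 1) → ℝ}
    (hr : (T - bottomRayleigh (T - c • vecMulVec u u) • (1 : Matrix (Fin (N + 1)) (Fin (N + 1)) ℝ)) *ᵥ r = u)
    {L m : ℝ} (hm : 0 ≤ m) (hr1 : OneSignedMargin L m r) {x : Fin (N + 1) → ℝ}
    (hx : IsBottomVector (T - c • vecMulVec u u) x) : OneSigned L x := by
  refine oneSigned_of_resolvent_oneSigned hsep hr ?_ hx
  rcases hr1 with h | h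
  · exact Or.inl fun y hy => hm.trans (h y hy)
  · exact Or.inr fun y hy => (h y hy).trans (neg_nonpos.2 hm)

/-! ## §4 A scoreable certificate for the separation hypothesis -/

/-- **PROVED — SEPARATION CERTIFICATE.** Any single vector `v ≠ 0` with `vᵀ(T − c·uuᵀ)v < ε₁(T)·|v|²` certifies
`ε₁(T − c·uuᵀ) < ε₁(T)`; with a LOWER bound `b ≤ ε₁(T)` (e.g. a box certificate) it suffices that
`vᵀ(T − c·uuᵀ)v < b|v|²`. [folklore] -/
theorem bottomRayleigh_rankOne_lt_of_witness {n : ℕ} {T : Matrix (Fin n) (Fin n) ℝ} {u : Fin n → ℝ} {c b : ℝ}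
    (hb : b ≤ bottomRayleigh T) {v : Fin n → ℝ} (hv : v ≠ 0)
    (hwit : v ⬝ᵥ ((T - c • vecMulVec u u) *ᵥ v) < b * (v ⬝ᵥ v)) :
    bottomRayleigh (T - c • vecMulVec u u) < bottomRayleigh T := by
  have hvv : 0 < v ⬝ᵥ v := dotSelf_pos_of_ne_zero hv
  have h1 := bottomRayleigh_le_rayleigh (T - c • vecMulVec u u) hv
  have h2 : v ⬝ᵥ ((T - c • vecMulVec u u) *ᵥ v) / (v ⬝ᵥ v) < b := (div_lt_iff₀ hvv).2 hwit
  linarith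

end Summit.RiemannHypothesis.RiemannHypothesis.Theorems.PfPersistence

end
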